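import Literature.Computability.Complexity.FlatRunTranscripts
import Literature.Computability.Complexity.PermutationNetworks
import Literature.Computability.Complexity.ThreeCNFCompiler
import HarnessLib

/-!
# The quasi-linear tableau of a flat stack program, I: variables and local constraints

Literature / circuit complexity (serves `williams_acc` through the leaf
`Williams2014_fact_3_1_skeleton` of `SuccinctSkeletonReductions.lean`: Williams 2014, Fact 3.1
in the skeleton form of Fortnow–Lipton–van Melkebeek–Viglas 2005, §3.1 — every
`L ∈ NTIME[2ⁿ]` reduces to `3SAT` instances of `2ⁿ · poly(n)` clauses whose `i`-th clause is a
function of `n`, `i` and the input bit `xᵢ`, computable in `poly(n)` time). This file and its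
sequels (`…Sound`, `…Complete`, `…Layout`, …) CONSTRUCT such a reduction for the flat binary
stack programs of `SymbolPrograms.lean` (which simulate Mathlib's `TM2` machines with linear
overhead, `TM2Flat.exists_aprogFin_of_outputsWithin`), following the classical recipe for
quasi-linear Cook–Levin theorems (Gurevich–Shelah 1989; Robson 1991; FLvMV 2005, §3.1):

* the computation is GUESSED as a transcript — one-hot program counters `u s q` and, inside
  the stack records, the claimed popped symbols — and checked by local constraints in time
  order (`FlatRunTranscripts.lean`);
* the consistency of each of the `K` stacks is checked on a RE-ORDERING of its `S = 2ᵏ`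
  records (type, symbol, level = stack height of the touched cell, time) produced by a Beneš
  permutation network with guessed switches (`PermutationNetworks.lean`): in key order
  (level, time) neighbouring records must be strictly increasing and every `pop` must sit next
  to the `push` it answers (`StackEventConsistency.lean`);
* stack heights are guessed in binary and checked by carry chains; keys are compared by scan
  chains; every constraint involves at most six variables and is compiled to `3`-clauses
  uniformly (`ThreeCNFCompiler.lean`).

The timeline `s < S` consists of the *virtual input phase* (`s < I = Y + 2n + 2`: the input
register is loaded with `⟨x, y⟩ = boolPair x y` by pushes — first the `Y` witness slots, bottom
up, a slot pushing only if present, then the `2n + 2` symbols of the doubled input, which are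
INPUT-COPY VARIABLES `x j`, so that the input enters the formula only through the unit clauses
`x j = xⱼ`), the *machine phase* (`I ≤ s < Send = I + T`: `T` steps of the program), the *final
check* (`s = Send`: a pop of the output register claiming the symbol `true`) and idle steps.

Contents of this file: the parameter record `TabParams`, the variables `TabVar K`, the record
format, bit-vector chain lemmas (`bval`, increment/decrement/comparison/equality chains), and
the conjunction `TabOK` of all local constraints, stated family by family as Boolean equations
(the form in which `…Layout` compiles them and `…Sound`/`…Complete` use them).

## References

* R. Williams, *Nonuniform ACC circuit lower bounds*, J. ACM 61 (2014), Fact 3.1, Thm. 3.3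
  [Williams2014].
* L. Fortnow, R. Lipton, D. van Melkebeek, A. Viglas, *Time-space lower bounds for
  satisfiability*, J. ACM 52 (2005) 835–865, §3.1 [FortnowEtAl2005].
* Y. Gurevich, S. Shelah, *Nearly linear time*, LNCS 363 (1989) 108–118 [GurevichShelah1989].
* S. A. Cook, *The complexity of theorem-proving procedures*, STOC 1971 [Cook1971].
-/

namespace Literature.Computability.Complexity

namespace Tableau

open StackEvents FlatRun Benes

/-! ### Bit vectors and scan chains -/

/-- The value of the first `m` bits of `f` (least significant first). [folklore] -/
def bval (f : ℕ → Bool) : ℕ → ℕ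
  | 0 => 0
  | m + 1 => bval f m + (if f m then 2 ^ m else 0)

/-- `bval f m < 2 ^ m`. [folklore] -/
theorem bval_lt (f : ℕ → Bool) : ∀ m, bval f m < 2 ^ m
  | 0 => Nat.one_pos
  | m + 1 => by
    have := bval_lt f m
    show bval f m + (if f m then 2 ^ m else 0) < 2 ^ (m + 1)
    rw [Nat.pow_succ]; split_ifs <;> omega

/-- `bval` only reads the first `m` bits. [folklore] -/
theorem bval_congr {f g : ℕ → Bool} : ∀ {m}, (∀ j < m, f j = g j) → bval f m = bval g m
  | 0, _ => rfl
  | m + 1, h => by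
    show bval f m + _ = bval g m + _
    rw [bval_congr (fun j hj => h j (Nat.lt_succ_of_lt hj)), h m (Nat.lt_succ_self m)]

/-- Two bit vectors with the same value agree. [folklore] -/
theorem bits_eq_of_bval_eq {f g : ℕ → Bool} : ∀ {m}, bval f m = bval g m → ∀ j < m, f j = g j
  | 0, _, j, hj => absurd hj (Nat.not_lt_zero j)
  | m + 1, h, j, hj => by
    have hf := bval_lt f m
    have hg := bval_lt g m
    change bval f m + (if f m then 2 ^ m else 0) = bval g m + (if g m then 2 ^ m else 0) at h
    have hm : f m = g m ∧ bval f m = bval g m := by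
      cases hfm : f m <;> cases hgm : g m <;> simp [hfm, hgm] at h ⊢ <;> omega
    rcases Nat.lt_succ_iff_lt_or_eq.1 hj with hj | rfl
    · exact bits_eq_of_bval_eq hm.2 j hj
    · exact hm.1

/-- The bits of a number: `bval (bit · s) m = s % 2 ^ m`. [folklore] -/
theorem bval_bit (s : ℕ) : ∀ m, bval (fun j => ThreeCNF.bit j s) m = s % 2 ^ m
  | 0 => by simp [bval, Nat.mod_one]
  | m + 1 => by
    show bval (fun j => ThreeCNF.bit j s) m + (if ThreeCNF.bit m s then 2 ^ m else 0) = _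
    rw [bval_bit s m]
    simp only [ThreeCNF.bit, decide_eq_true_eq]
    have h1 : s % 2 ^ (m + 1) = s % 2 ^ m + 2 ^ m * (s / 2 ^ m % 2) := by
      rw [Nat.pow_succ, Nat.mod_mul]
    rw [h1]
    have := Nat.mod_two_eq_zero_or_one (s / 2 ^ m)
    split_ifs with h <;> simp_all

/-- **Increment chain**: bits `a'` with carries `c` (`c 0 = 1`, `a'ⱼ = aⱼ ⊕ cⱼ`,
`cⱼ₊₁ = aⱼ ∧ cⱼ`) represent `a + 1`, the final carry accounting for overflow. [folklore] -/
theorem inc_chain {a a' c : ℕ → Bool} (h0 : c 0 = true) :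
    ∀ m, (∀ j < m, a' j = (a j ^^ c j) ∧ c (j + 1) = (a j && c j)) →
      bval a' m + (if c m then 2 ^ m else 0) = bval a m + 1
  | 0, _ => by simp [bval, h0]
  | m + 1, h => by
    have ih := inc_chain h0 m (fun j hj => h j (Nat.lt_succ_of_lt hj))
    obtain ⟨h1, h2⟩ := h m (Nat.lt_succ_self m)
    show bval a' m + (if a' m then 2 ^ m else 0) + (if c (m + 1) then 2 ^ (m + 1) else 0) =
      bval a m + (if a m then 2 ^ m else 0) + 1
    rw [h1, h2, Nat.pow_succ]
    revert ih
    cases a m <;> cases c m <;> simp <;> omega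

/-- **Decrement chain**: bits `a'` with borrows `b` (`b 0 = 1`, `a'ⱼ = aⱼ ⊕ bⱼ`,
`bⱼ₊₁ = ¬aⱼ ∧ bⱼ`) represent `a - 1`, the final borrow accounting for underflow. [folklore] -/
theorem dec_chain {a a' b : ℕ → Bool} (h0 : b 0 = true) :
    ∀ m, (∀ j < m, a' j = (a j ^^ b j) ∧ b (j + 1) = (!a j && b j)) →
      bval a' m + 1 = bval a m + (if b m then 2 ^ m else 0)
  | 0, _ => by simp [bval, h0]
  | m + 1, h => by
    have ih := dec_chain h0 m (fun j hj => h j (Nat.lt_succ_of_lt hj))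
    obtain ⟨h1, h2⟩ := h m (Nat.lt_succ_self m)
    show bval a' m + (if a' m then 2 ^ m else 0) + 1 =
      bval a m + (if a m then 2 ^ m else 0) + (if b (m + 1) then 2 ^ (m + 1) else 0)
    rw [h1, h2, Nat.pow_succ]
    revert ih
    cases a m <;> cases b m <;> simp <;> omega

/-- **Comparison chain** (least significant bit first, the higher bit decides):
`l₀ = 0`, `lᵢ₊₁ = if aᵢ = bᵢ then lᵢ else bᵢ`; then `lₘ = [a < b]`. [folklore] -/
theorem lt_chain {a b l : ℕ → Bool} (h0 : l 0 = false) :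
    ∀ m, (∀ i < m, l (i + 1) = (if a i = b i then l i else b i)) →
      (l m = true ↔ bval a m < bval b m)
  | 0, _ => by simp [bval, h0]
  | m + 1, h => by
    have ih := lt_chain h0 m (fun j hj => h j (Nat.lt_succ_of_lt hj))
    have ha := bval_lt a m
    have hb := bval_lt b m
    rw [h m (Nat.lt_succ_self m)]
    show _ ↔ bval a m + (if a m then 2 ^ m else 0) < bval b m + (if b m then 2 ^ m else 0)
    revert ih
    cases a m <;> cases b m <;> cases l m <;> simp <;> omega

/-- **Equality chain**: `e₀ = 1`, `eⱼ₊₁ = eⱼ ∧ (aⱼ = bⱼ)`; then `eₘ = [∀ j < m, aⱼ = bⱼ]`.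
[folklore] -/
theorem eq_chain {a b e : ℕ → Bool} (h0 : e 0 = true) :
    ∀ m, (∀ j < m, e (j + 1) = (e j && (a j == b j))) → (e m = true ↔ ∀ j < m, a j = b j)
  | 0, _ => by simp [h0]
  | m + 1, h => by
    have ih := eq_chain h0 m (fun j hj => h j (Nat.lt_succ_of_lt hj))
    rw [h m (Nat.lt_succ_self m), Bool.and_eq_true, ih, beq_iff_eq]
    constructor
    · rintro ⟨h1, h2⟩ j hj
      rcases Nat.lt_succ_iff_lt_or_eq.1 hj with hj | rfl
      · exact h1 j hj
      · exact h2
    · intro h1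
      exact ⟨fun j hj => h1 j (Nat.lt_succ_of_lt hj), h1 m (Nat.lt_succ_self m)⟩

/-! ### Parameters, variables, record format -/

/-- The parameters of a tableau: a flat program `P` on `K` binary registers with input register
`inp` and output register `out`, the input length `n`, the number `Y` of witness slots, the
number `T` of machine steps, and the logarithm `k` of the timeline length `S = 2ᵏ`.
[cite: FortnowEtAl2005, §3.1] -/
structure TabParams where
  /-- number of registers -/
  K : ℕ
  /-- the flat program -/
  P : AProg Bool (Fin K)
  /-- input register -/
  inp : Fin K
  /-- output register -/
  out : Fin K
  /-- input length -/
  n : ℕ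
  /-- witness slots -/
  Y : ℕ
  /-- machine steps -/
  T : ℕ
  /-- `S = 2 ^ k` -/
  k : ℕ

/-- Record field: high type bit (`1` = pop). [folklore] -/
def fT1 : ℕ := 0
/-- Record field: low type bit (`push = 01`, `popNone = 10`, `popSome = 11`, `nop = 00`).
[folklore] -/
def fT0 : ℕ := 1
/-- Record field: symbol. [folklore] -/
def fSym : ℕ := 2
/-- Record field: level bit `j ≤ k`. [folklore] -/
def fLev (j : ℕ) : ℕ := 3 + j

namespace TabParams

variable (tb : TabParams)

/-- Start of the machine phase: after the `Y + (2n + 2)` virtual pushes. [folklore] -/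
def I : ℕ := tb.Y + (2 * tb.n + 2)
/-- End of the machine phase (time of the final check). [folklore] -/
def Send : ℕ := tb.I + tb.T
/-- Length of the timeline and size of the permutation networks. [folklore] -/
def S : ℕ := 2 ^ tb.k
/-- Number of network layers. [folklore] -/
def L : ℕ := 2 * tb.k
/-- Width of a record: two type bits, a symbol bit, `k + 1` level bits, `k` time bits.
[folklore] -/
def W : ℕ := 2 * tb.k + 4
/-- Record field: time bit `j < k`. [folklore] -/
def fTim (j : ℕ) : ℕ := tb.k + 4 + j
/-- Key bit `i < 2k + 1` (time bits below level bits, least significant first). [folklore] -/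
def fKey (i : ℕ) : ℕ := if i < tb.k then tb.fTim i else fLev (i - tb.k)
/-- Dimension of network layer `ℓ`. [folklore] -/
def dim (ℓ : ℕ) : ℕ := (dims tb.k).getD ℓ 0
/-- Length of the program (the halting address). [folklore] -/
def np : ℕ := tb.P.length

end TabParams

/-- The variables of a tableau over `K` registers. [cite: FortnowEtAl2005, §3.1] -/
inductive TabVar (K : ℕ) : Type
  /-- input copy `xⱼ` -/
  | x (j : ℕ) : TabVar K
  /-- witness slot `j` is present -/
  | yp (j : ℕ) : TabVar K
  /-- value of witness slot `j` -/
  | yv (j : ℕ) : TabVar K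
  /-- the program counter at time `s` is `q` -/
  | u (s q : ℕ) : TabVar K
  /-- bit `j` of the height of register `κ` before event `s` -/
  | h (κ : Fin K) (s j : ℕ) : TabVar K
  /-- carry/borrow bit `j` of the height update of register `κ` at time `s` -/
  | hc (κ : Fin K) (s j : ℕ) : TabVar K
  /-- bit `w` of the record at layer `ℓ`, position `p` of the network of register `κ` -/
  | r (κ : Fin K) (ℓ p w : ℕ) : TabVar K
  /-- switch `q` of layer `ℓ` of the network of register `κ` -/
  | sw (κ : Fin K) (ℓ q : ℕ) : TabVar K
  /-- comparison chain of output positions `p`, `p + 1`, after `i` key bits -/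
  | lt (κ : Fin K) (p i : ℕ) : TabVar K
  /-- level-equality chain of output positions `p`, `p + 1`, after `j` level bits -/
  | ae (κ : Fin K) (p j : ℕ) : TabVar K
  /-- auxiliary variable `m` of constraint `c` (clause compilation) -/
  | aux (c m : ℕ) : TabVar K
  /-- a padding variable -/
  | dummy : TabVar K
  deriving DecidableEq

/-! ### The local constraints -/

section Spec

variable (tb : TabParams) (τ : TabVar tb.K → Bool)

/-- Shorthand: bit `w` of the record of register `κ` at layer `ℓ`, position `p`. [folklore] -/
def R (κ : Fin tb.K) (ℓ p w : ℕ) : Bool := τ (.r κ ℓ p w)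

/-- The source of the symbol pushed at position `r` of the doubled-input phase: the pushes
spell `(boolPair x y)` above `y`, bottom up, i.e. `true`, `false`, then `x_{n-1}, x_{n-1}, …,
x₀, x₀`; a source is a constant or an input-copy variable. [folklore] -/
def v2src (n r : ℕ) : Bool ⊕ ℕ :=
  if r = 0 then .inl true else if r = 1 then .inl false else .inr (n - 1 - (r - 2) / 2)

/-- The value of a symbol source under `τ`. [folklore] -/
def srcVal : Bool ⊕ ℕ → Bool
  | .inl b => b
  | .inr j => τ (.x j)

/-- The record specification of register `κ` for the instruction at `q` (machine phase): a
push of `κ` records `push a`; a pop of `κ` records a pop (its low type bit and symbol are the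
GUESSED popped claim); anything else records `nop`. [cite: FortnowEtAl2005, §3.1] -/
def MSpec (κ : Fin tb.K) (q s : ℕ) : Prop :=
  match tb.P[q]? with
  | some (.push κ' a) =>
    if κ' = κ then R tb τ κ 0 s fT1 = false ∧ R tb τ κ 0 s fT0 = true ∧ R tb τ κ 0 s fSym = a
    else R tb τ κ 0 s fT1 = false ∧ R tb τ κ 0 s fT0 = false
  | some (.pop κ' _) =>
    if κ' = κ then R tb τ κ 0 s fT1 = true
    else R tb τ κ 0 s fT1 = false ∧ R tb τ κ 0 s fT0 = false
  | _ => R tb τ κ 0 s fT1 = false ∧ R tb τ κ 0 s fT0 = false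

/-- The popped claim of a pop instruction at `q` executed at time `s`, read off the record of
the popped register (`none` for other instructions). [folklore] -/
def oClaim (q s : ℕ) : Option Bool :=
  match tb.P[q]? with
  | some (.pop κ' _) => if R tb τ κ' 0 s fT0 then some (R tb τ κ' 0 s fSym) else none
  | _ => none

/-- The jump target of the instruction at `q` with popped claim `o`. [folklore] -/
def target (q : ℕ) (o : Option Bool) : ℕ :=
  match tb.P[q]? with
  | none => q
  | some (.push _ _) => q + 1
  | some (.goto j) => j
  | some (.pop _ j) => j o

/-- Slots at which register `κ` does nothing by schedule: other registers during the virtual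
input phase, other registers at the final check, everything after it. [folklore] -/
def NopSlot (κ : Fin tb.K) (s : ℕ) : Prop :=
  (s < tb.I ∧ κ ≠ tb.inp) ∨ (s = tb.Send ∧ κ ≠ tb.out) ∨ tb.Send < s

/-- The height-update relation of one bit: by record type, keep (`nop`), increment with carry
(`push`), force zero (`popNone`), decrement with borrow (`popSome`). [folklore] -/
def HStepRel (t1 t0 a c a' c' : Bool) : Prop :=
  match t1, t0 with
  | false, false => a' = a
  | false, true => a' = (a ^^ c) ∧ c' = (a && c)
  | true, false => a = false ∧ a' = false
  | true, true => a' = (a ^^ c) ∧ c' = (!a && c)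

/-- **The local constraints of the tableau** with parameters `tb` on the assignment `τ`, family
by family (each instance reads at most six variables). [cite: FortnowEtAl2005, §3.1] -/
structure TabOK : Prop where
  /-- Virtual phase 1: slot `Y - 1 - s` of the witness is pushed on `inp` if present. -/
  recV1 : ∀ s < tb.Y, R tb τ tb.inp 0 s fT1 = false ∧
    R tb τ tb.inp 0 s fT0 = τ (.yp (tb.Y - 1 - s)) ∧ R tb τ tb.inp 0 s fSym = τ (.yv (tb.Y - 1 - s))
  /-- Virtual phase 2: the doubled input is pushed on `inp`. -/
  recV2 : ∀ r < 2 * tb.n + 2, R tb τ tb.inp 0 (tb.Y + r) fT1 = false ∧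
    R tb τ tb.inp 0 (tb.Y + r) fT0 = true ∧ R tb τ tb.inp 0 (tb.Y + r) fSym = srcVal tb τ (v2src tb.n r)
  /-- Scheduled idle slots record `nop`. -/
  recNop : ∀ κ, ∀ s < tb.S, NopSlot tb κ s → R tb τ κ 0 s fT1 = false ∧ R tb τ κ 0 s fT0 = false
  /-- Machine phase: the active instruction determines the records. -/
  recM : ∀ κ s, tb.I ≤ s → s < tb.Send → ∀ q ≤ tb.np, τ (.u s q) = true → MSpec tb τ κ q s
  /-- Final check: a pop of `out` claiming `true`. -/
  recF : R tb τ tb.out 0 tb.Send fT1 = true ∧ R tb τ tb.out 0 tb.Send fT0 = true ∧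
    R tb τ tb.out 0 tb.Send fSym = true
  /-- Time bits of a record are the bits of its time. -/
  time : ∀ κ, ∀ s < tb.S, ∀ j < tb.k, R tb τ κ 0 s (tb.fTim j) = ThreeCNF.bit j s
  /-- Level bits: the new height for a push, the old height for a `popSome`, else `0`. -/
  lev : ∀ κ, ∀ s < tb.S, ∀ j ≤ tb.k, R tb τ κ 0 s (fLev j) =
    (if R tb τ κ 0 s fT1 = false ∧ R tb τ κ 0 s fT0 = true then τ (.h κ (s + 1) j)
     else if R tb τ κ 0 s fT1 = true ∧ R tb τ κ 0 s fT0 = true then τ (.h κ s j) else false)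
  /-- Heights start at `0`. -/
  h0 : ∀ κ, ∀ j ≤ tb.k, τ (.h κ 0 j) = false
  /-- The carry/borrow chain starts with `1`. -/
  hc0 : ∀ κ, ∀ s < tb.S, τ (.hc κ s 0) = true
  /-- No overflow on a push, no underflow on a `popSome`. -/
  hcK : ∀ κ, ∀ s < tb.S, R tb τ κ 0 s fT0 = true → τ (.hc κ s (tb.k + 1)) = false
  /-- The height update, bit by bit. -/
  hstep : ∀ κ, ∀ s < tb.S, ∀ j ≤ tb.k, HStepRel (R tb τ κ 0 s fT1) (R tb τ κ 0 s fT0)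
    (τ (.h κ s j)) (τ (.hc κ s j)) (τ (.h κ (s + 1) j)) (τ (.hc κ s (j + 1)))
  /-- The machine starts at address `0`. -/
  u0 : τ (.u tb.I 0) = true
  /-- At most one program counter at a time. -/
  u2 : ∀ s, tb.I ≤ s → s ≤ tb.Send → ∀ q q', q < q' → q' ≤ tb.np →
    ¬ (τ (.u s q) = true ∧ τ (.u s q') = true)
  /-- Transitions: the active instruction with its popped claim activates its target, which is
  a genuine address. -/
  tr : ∀ s, tb.I ≤ s → s < tb.Send → ∀ q ≤ tb.np, τ (.u s q) = true →
    target tb q (oClaim tb τ q s) ≤ tb.np ∧ τ (.u (s + 1) (target tb q (oClaim tb τ q s))) = true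
  /-- Acceptance: the machine has halted at the final check. -/
  acc : τ (.u tb.Send tb.np) = true
  /-- The permutation networks: each layer moves records along its switches. -/
  net : ∀ κ, ∀ ℓ < tb.L, ∀ p < tb.S, ∀ w < tb.W, R tb τ κ (ℓ + 1) p w =
    (if τ (.sw κ ℓ (base (tb.dim ℓ) p)) then R tb τ κ ℓ (flipBit (tb.dim ℓ) p) w else R tb τ κ ℓ p w)
  /-- Comparison chains start with `0`. -/
  lt0 : ∀ κ p, p + 1 < tb.S → τ (.lt κ p 0) = false
  /-- Comparison chains scan the key bits. -/
  ltStep : ∀ κ p, p + 1 < tb.S → ∀ i < 2 * tb.k + 1, τ (.lt κ p (i + 1)) =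
    (if R tb τ κ tb.L p (tb.fKey i) = R tb τ κ tb.L (p + 1) (tb.fKey i) then τ (.lt κ p i)
     else R tb τ κ tb.L (p + 1) (tb.fKey i))
  /-- Output records strictly increase in key order. -/
  ltF : ∀ κ p, p + 1 < tb.S → τ (.lt κ p (2 * tb.k + 1)) = true
  /-- Level-equality chains start with `1`. -/
  ae0 : ∀ κ p, p + 1 < tb.S → τ (.ae κ p 0) = true
  /-- Level-equality chains scan the level bits. -/
  aeStep : ∀ κ p, p + 1 < tb.S → ∀ j ≤ tb.k, τ (.ae κ p (j + 1)) =
    (τ (.ae κ p j) && (R tb τ κ tb.L p (fLev j) == R tb τ κ tb.L (p + 1) (fLev j)))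
  /-- A `popSome` is preceded by a push of the same level … -/
  adj1 : ∀ κ p, p + 1 < tb.S → R tb τ κ tb.L (p + 1) fT1 = true → R tb τ κ tb.L (p + 1) fT0 = true →
    R tb τ κ tb.L p fT1 = false ∧ R tb τ κ tb.L p fT0 = true ∧ τ (.ae κ p (tb.k + 1)) = true
  /-- … and of the same symbol. -/
  adj2 : ∀ κ p, p + 1 < tb.S → R tb τ κ tb.L (p + 1) fT1 = true → R tb τ κ tb.L (p + 1) fT0 = true →
    R tb τ κ tb.L p fSym = R tb τ κ tb.L (p + 1) fSym
  /-- The key-smallest record is not a `popSome`. -/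
  first : ∀ κ, ¬ (R tb τ κ tb.L 0 fT1 = true ∧ R tb τ κ tb.L 0 fT0 = true)

end Spec

end Tableau

end Literature.Computability.Complexity
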